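import Literature.MathematicalPhysics.QuantumLattice.FermionStrongSubadditivity
import Literature.MathematicalPhysics.QuantumLattice.GibbsVariationalPrinciple
import Mathlib.Algebra.Order.Group.PiLex
import HarnessLib

/-!
# The entropy chain rule with strong subadditivity for even lattice-fermion states:
# `S(ρ_Ω) ≤ Σ_x S(x | sites of Ω below x)` and the Markov (window) bound

Topic `MathematicalPhysics/QuantumLattice`, namespace `Literature.MathematicalPhysics.QuantumLattice`.

Let `Ω ⊆ ℤ^d` be a finite region, `ρ` an EVEN density matrix on its local CAR algebra `𝔄_Ω = FermionOp Ω`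
(Jordan–Wigner in the lexicographic site order of the tree), and for a sub-region `S ⊆ Ω` let
`S_ρ(S)` be the von Neumann entropy of the restriction of `ρ` to `𝔄_S` (`regionEntropy`, through
`fermionPartialTrace (PolySite.incl _)` of `FermionPartialTrace.lean`). Enumerating the sites of `Ω` in
lexicographic order, the entropy telescopes into the conditional entropies of each site given the sites
below it,

  `S(ρ) = Σ_{x ∈ Ω} [S_ρ(Ω_{≤x}) − S_ρ(Ω_{<x})]`                      (`sum_entropyIncrement`),

and by STRONG SUBADDITIVITY for even states of the Fermion algebra (`fermion_strongSubadditivity`,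
Araki–Moriya) each increment is bounded by the conditional entropy of `x` given ANY sub-region
`W ∖ {x} ⊆ Ω_{<x}`: for a WINDOW `Λ` whose lexicographically largest site is `a` and a translate
`Λ + v ⊆ Ω`, the site `x = a + v` has all of `Λ + v` below it, so

  `S_ρ(Ω_{≤a+v}) − S_ρ(Ω_{<a+v}) ≤ S_ρ(Λ + v) − S_ρ((Λ ∖ a) + v)`      (`entropyIncrement_corner_le`),

while every increment is `≤ log 4` (subadditivity; one site carries a four-dimensional Fock space,
`entropyIncrement_le_log_four`). Consequently (`vonNeumannEntropy_le_of_window_entropies`): if the window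
entropies are the same for all translates `v ∈ V` — `S_ρ(Λ+v) = c_Λ`, `S_ρ((Λ∖a)+v) = c_B` (translation
invariance) — then

  `S(ρ) ≤ |V| · (c_Λ − c_B) + (|Ω| − |V|) · log 4`.

This is the entropy half of the MARKOV / conditional-entropy upper bound on the pressure of a
translation-invariant state ("the entropy density is at most the conditional entropy of a site given a
finite shield in its lexicographic past"), the variational dual of the Markov entropy decomposition
[cite: PoulinHastings2011, eqs. (3)–(6)]; for classical lattice systems it is the Kikuchi / CVM upper bound
on the entropy, and in one dimension it is the monotone limit `s = lim S(1 | 2…n)` of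
[cite: BratteliRobinsonII1997, Prop. 6.2.38 ff.]. The fermionic input is only the SSA of
[cite: ArakiMoriya2003, Theorem 3.8 and §10]. Consumers: the thermal free-energy (pressure) certificates
of the Hubbard programme (`hubbard-thermal`, technique (ii)), where `Ω = [0,L)^d` is the pulled-back torus.

Everything is PROVED; no named fact. Definitions (with bodies, bookkeeping): `sitesBelow`,
`sitesBelowEq`, `regionEntropy`, `entropyIncrement`.
-/

noncomputable section

namespace Literature.MathematicalPhysics.QuantumLattice

open Matrix Finset HubbardWave0 Literature.Probability.LatticeModels
open scoped ComplexOrder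
open Literature.InformationTheory.Entropy (vonNeumannEntropy vonNeumannEntropy_eq sum_eigenvalues_eq_one)

variable {d : ℕ}

/-! ### §1. Regions below a site; region entropies -/

/-- The sites of `Ω` strictly below `x` in the lexicographic order. [folklore] -/
def sitesBelow (Ω : Finset (Site d)) (x : Lex (Site d)) : Finset (Site d) := Ω.filter fun y => toLex y < x

/-- The sites of `Ω` below or equal to `x` in the lexicographic order. [folklore] -/
def sitesBelowEq (Ω : Finset (Site d)) (x : Lex (Site d)) : Finset (Site d) := Ω.filter fun y => toLex y ≤ x

/-- Membership in `sitesBelow` (the lexicographic past of `x` inside `Ω`). [cite: PoulinHastings2011, eq. (3)] -/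
@[simp] theorem mem_sitesBelow {Ω : Finset (Site d)} {x : Lex (Site d)} {y : Site d} :
    y ∈ sitesBelow Ω x ↔ y ∈ Ω ∧ toLex y < x := Finset.mem_filter

/-- Membership in `sitesBelowEq` (the lexicographic past of `x` inside `Ω`, with `x`). [cite: PoulinHastings2011, eq. (3)] -/
@[simp] theorem mem_sitesBelowEq {Ω : Finset (Site d)} {x : Lex (Site d)} {y : Site d} :
    y ∈ sitesBelowEq Ω x ↔ y ∈ Ω ∧ toLex y ≤ x := Finset.mem_filter

/-- **The entropy of the restriction of `ρ ∈ 𝔄_Ω` to the sub-region `S ⊆ Ω`**, `S_ρ(S) = S(tr_{Ω∖S} ρ)`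
(junk value `0` if `S ⊄ Ω`). Araki–Moriya §3.1 (entropy of the restriction of a state to `𝔄(I)`).
[cite: ArakiMoriya2003, §3.1] -/
def regionEntropy {Ω : Finset (Site d)} (ρ : FermionOp Ω) (S : Finset (Site d)) : ℝ :=
  if h : S ⊆ Ω then vonNeumannEntropy (fermionPartialTrace (PolySite.incl h) ρ) else 0

/-- `regionEntropy` on a sub-region (unfolding). [cite: ArakiMoriya2003, §3.1] -/
theorem regionEntropy_of_subset {Ω : Finset (Site d)} (ρ : FermionOp Ω) {S : Finset (Site d)} (h : S ⊆ Ω) :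
    regionEntropy ρ S = vonNeumannEntropy (fermionPartialTrace (PolySite.incl h) ρ) := by
  rw [regionEntropy, dif_pos h]

/-- **The entropy increment at `x`**: `S_ρ(Ω_{≤x}) − S_ρ(Ω_{<x})`, the conditional entropy of the site
`x` given the sites of `Ω` below it. [cite: PoulinHastings2011, eq. (3)] -/
def entropyIncrement {Ω : Finset (Site d)} (ρ : FermionOp Ω) (x : Lex (Site d)) : ℝ :=
  regionEntropy ρ (sitesBelowEq Ω x) - regionEntropy ρ (sitesBelow Ω x)

/-- The range of the isotony embedding `PolySite.incl (S ⊆ Ω)` is the set of sites of `Ω` lying in `S`.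
[folklore] -/
private theorem range_incl {S Ω : Finset (Site d)} (h : S ⊆ Ω) :
    Set.range (PolySite.incl h) = {y : PolySite Ω | ofLex y.1 ∈ S} := by
  ext y
  constructor
  · rintro ⟨z, rfl⟩
    exact PolySite.ofLex_mem z
  · intro hy
    exact ⟨PolySite.pt (ofLex y.1) hy, Subtype.ext rfl⟩

/-! ### §2. The telescoping identity -/

/-- The Fock space over the empty region: `PolySite ∅` has no sites. [folklore] -/
private theorem isEmpty_polySite_empty : IsEmpty (PolySite (∅ : Finset (Site d))) :=
  ⟨fun y => by simpa using (mem_lexSites.1 y.2)⟩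

/-- `S_ρ(∅) = 0`: the restriction to the empty region is the unique state of `ℂ`.
[cite: NielsenChuang2010, Theorem 11.8 (1) p.513] -/
theorem regionEntropy_empty {Ω : Finset (Site d)} {ρ : FermionOp Ω} (hρ : ρ.IsHermitian) (htr : ρ.trace = 1) :
    regionEntropy ρ ∅ = 0 := by
  rw [regionEntropy_of_subset ρ (Finset.empty_subset Ω)]
  haveI := (isEmpty_polySite_empty (d := d))
  exact vonNeumannEntropy_eq_zero_of_isEmpty (isHermitian_fermionPartialTrace _ hρ)
    (by rw [trace_fermionPartialTrace, htr])

/-- `S_ρ(Ω) = S(ρ)`: nothing is traced out. [cite: ArakiMoriya2003, §3.1] -/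
theorem regionEntropy_self {Ω : Finset (Site d)} (ρ : FermionOp Ω) : regionEntropy ρ Ω = vonNeumannEntropy ρ := by
  rw [regionEntropy_of_subset ρ (subset_refl Ω), PolySite.incl_rfl, fermionPartialTrace_refl]

/-- **Chain rule (telescoping)**: summing the entropy increments over the sites of `Ω` in lexicographic
order gives the total entropy, `Σ_{x ∈ Ω} [S_ρ(Ω_{≤x}) − S_ρ(Ω_{<x})] = S(ρ)`.
[cite: PoulinHastings2011, eq. (3)] [cite: NielsenChuang2010, Theorem 11.16 (chaining) p.522] -/
theorem sum_entropyIncrement {Ω : Finset (Site d)} {ρ : FermionOp Ω} (hρ : ρ.IsHermitian) (htr : ρ.trace = 1) :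
    ∑ x ∈ lexSites Ω, entropyIncrement ρ x = vonNeumannEntropy ρ := by
  classical
  set N : ℕ := (lexSites Ω).card with hN
  set e : Fin N ↪o Lex (Site d) := (lexSites Ω).orderEmbOfFin hN.symm with he
  have he_range : Set.range e = ↑(lexSites Ω) := Finset.range_orderEmbOfFin _ _
  have he_mem : ∀ y : Site d, y ∈ Ω → ∃ i : Fin N, e i = toLex y := fun y hy => by
    have : toLex y ∈ Set.range e := by rw [he_range, Finset.mem_coe, mem_lexSites]; exact hy
    exact this
  -- the `k` smallest sites of `Ω`
  let A : ℕ → Finset (Site d) := fun k => Ω.filter fun y => ∃ i : Fin N, (i : ℕ) < k ∧ e i = toLex y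
  have hA : ∀ i : Fin N, A i = sitesBelow Ω (e i) := by
    intro i
    ext y
    simp only [A, Finset.mem_filter, mem_sitesBelow, and_congr_right_iff]
    intro hy
    constructor
    · rintro ⟨j, hj, hjy⟩
      rw [← hjy]
      exact e.strictMono (Fin.lt_def.2 hj)
    · intro hlt
      obtain ⟨j, hj⟩ := he_mem y hy
      refine ⟨j, ?_, hj⟩
      rw [← hj] at hlt
      exact Fin.lt_def.1 (e.lt_iff_lt.1 hlt)
  have hA' : ∀ i : Fin N, A (i + 1) = sitesBelowEq Ω (e i) := by
    intro i
    ext y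
    simp only [A, Finset.mem_filter, mem_sitesBelowEq, and_congr_right_iff]
    intro hy
    constructor
    · rintro ⟨j, hj, hjy⟩
      rw [← hjy]
      exact e.monotone (Fin.le_def.2 (Nat.lt_succ_iff.1 hj))
    · intro hle
      obtain ⟨j, hj⟩ := he_mem y hy
      refine ⟨j, ?_, hj⟩
      rw [← hj] at hle
      exact Nat.lt_succ_iff.2 (Fin.le_def.1 (e.le_iff_le.1 hle))
  have hA0 : A 0 = ∅ := by
    ext y
    simp [A]
  have hAN : A N = Ω := by
    ext y
    simp only [A, Finset.mem_filter, and_iff_left_iff_imp]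
    intro hy
    obtain ⟨i, hi⟩ := he_mem y hy
    exact ⟨i, i.2, hi⟩
  -- reindex the sum along `e` and telescope
  have hmap : (Finset.univ : Finset (Fin N)).map e.toEmbedding = lexSites Ω := by
    apply Finset.coe_injective
    rw [Finset.coe_map, Finset.coe_univ, Set.image_univ]
    exact he_range
  have hsum : ∑ x ∈ lexSites Ω, entropyIncrement ρ x = ∑ i : Fin N, entropyIncrement ρ (e.toEmbedding i) :=
    calc ∑ x ∈ lexSites Ω, entropyIncrement ρ x
        = ∑ x ∈ (Finset.univ : Finset (Fin N)).map e.toEmbedding, entropyIncrement ρ x :=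
          Finset.sum_congr hmap.symm fun _ _ => rfl
      _ = ∑ i : Fin N, entropyIncrement ρ (e.toEmbedding i) := Finset.sum_map _ _ _
  rw [hsum]
  have hterm : ∀ i : Fin N, entropyIncrement ρ (e.toEmbedding i) =
      regionEntropy ρ (A (i + 1)) - regionEntropy ρ (A i) := by
    intro i
    rw [entropyIncrement, hA i, hA' i]
    rfl
  simp_rw [hterm]
  rw [Fin.sum_univ_eq_sum_range (fun k => regionEntropy ρ (A (k + 1)) - regionEntropy ρ (A k)) N]
  refine (Finset.sum_range_sub (fun k => regionEntropy ρ (A k)) N).trans ?_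
  rw [hAN, hA0, regionEntropy_self, regionEntropy_empty hρ htr, sub_zero]

/-! ### §3. The increment at the top corner of a translated window; the generic `log 4` bound -/

/-- Translations preserve the lexicographic order of `ℤ^d`: `y − v ∈ Λ` and `Λ ≤ a` give `y ≤ a + v`.
[folklore] -/
private theorem toLex_le_toLex_add_of_sub_mem {Λ : Finset (Site d)} {a : Site d}
    (hmax : ∀ y ∈ Λ, toLex y ≤ toLex a) {v y : Site d} (hy : y - v ∈ Λ) : toLex y ≤ toLex (a + v) := by
  have h := add_le_add (hmax _ hy) (le_refl (toLex v))
  rwa [← toLex_add, ← toLex_add, sub_add_cancel] at h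

/-- **The increment at the top corner of a translated window is at most the window conditional entropy**:
if `a` is the lexicographically largest site of `Λ` and `Λ + v ⊆ Ω`, then for an even density matrix
`ρ ∈ 𝔄_Ω`,  `S_ρ(Ω_{≤a+v}) − S_ρ(Ω_{<a+v}) ≤ S_ρ(Λ+v) − S_ρ((Λ∖a)+v)` — strong subadditivity for the
Fermion algebra with `I = Ω_{<a+v}`, `J = Λ + v` (`I ∩ J = (Λ∖a)+v`, `I ∪ J = Ω_{≤a+v}`).
[cite: ArakiMoriya2003, Theorem 3.8 and §10] [cite: PoulinHastings2011, eqs. (4)–(6)] -/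
theorem entropyIncrement_corner_le {Ω Λ : Finset (Site d)} {a : Site d} (ha : a ∈ Λ)
    (hmax : ∀ y ∈ Λ, toLex y ≤ toLex a) {v : Site d} (hv : shiftSet v Λ ⊆ Ω)
    {ρ : FermionOp Ω} (hρ : ρ.PosSemidef) (htr : ρ.trace = 1) (hev : parityAut ρ = ρ) :
    entropyIncrement ρ (toLex (a + v)) ≤
      regionEntropy ρ (shiftSet v Λ) - regionEntropy ρ (shiftSet v (Λ.erase a)) := by
  have hBv : shiftSet v (Λ.erase a) ⊆ Ω := fun y hy => hv (by
    rw [mem_shiftSet] at hy ⊢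
    exact (Finset.mem_erase.1 hy).2)
  have hI : sitesBelow Ω (toLex (a + v)) ⊆ Ω := Finset.filter_subset _ _
  have hU : sitesBelowEq Ω (toLex (a + v)) ⊆ Ω := Finset.filter_subset _ _
  have hK : Set.range (PolySite.incl hBv) = Set.range (PolySite.incl hI) ∩ Set.range (PolySite.incl hv) := by
    ext y
    simp only [range_incl, Set.mem_setOf_eq, Set.mem_inter_iff, mem_shiftSet, Finset.mem_erase, mem_sitesBelow,
      toLex_ofLex]
    constructor
    · rintro ⟨hne, hyΛ⟩
      refine ⟨⟨hv (by rw [mem_shiftSet]; exact hyΛ), lt_of_le_of_ne (toLex_le_toLex_add_of_sub_mem hmax hyΛ) ?_⟩, hyΛ⟩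
      intro h
      apply hne
      rw [show ofLex y.1 = a + v from toLex_inj.1 (by rw [toLex_ofLex]; exact h), add_sub_cancel_right]
    · rintro ⟨⟨_, hlt⟩, hyΛ⟩
      refine ⟨fun h => ?_, hyΛ⟩
      have h' : ofLex y.1 = a + v := by rw [← h, sub_add_cancel]
      rw [← toLex_ofLex y.1, h'] at hlt
      exact lt_irrefl _ hlt
  have hUr : Set.range (PolySite.incl hU) = Set.range (PolySite.incl hI) ∪ Set.range (PolySite.incl hv) := by
    ext y
    simp only [range_incl, Set.mem_setOf_eq, Set.mem_union, mem_shiftSet, mem_sitesBelow, mem_sitesBelowEq,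
      toLex_ofLex]
    constructor
    · rintro ⟨hyΩ, hle⟩
      rcases hle.lt_or_eq with hlt | heq
      · exact Or.inl ⟨hyΩ, hlt⟩
      · right
        rw [show ofLex y.1 = a + v from toLex_inj.1 (by rw [toLex_ofLex]; exact heq), add_sub_cancel_right]
        exact ha
    · rintro (⟨hyΩ, hlt⟩ | hyΛ)
      · exact ⟨hyΩ, hlt.le⟩
      · exact ⟨hv (by rw [mem_shiftSet]; exact hyΛ), by
          rw [← toLex_ofLex y.1]; exact toLex_le_toLex_add_of_sub_mem hmax hyΛ⟩
  have key := fermion_strongSubadditivity (PolySite.incl hI) (PolySite.incl hv) (PolySite.incl hBv)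
    (PolySite.incl hU) hK hUr hρ htr hev
  rw [entropyIncrement, regionEntropy_of_subset ρ hU, regionEntropy_of_subset ρ hI, regionEntropy_of_subset ρ hv,
    regionEntropy_of_subset ρ hBv]
  linarith

/-- **The entropy of a density matrix is at most `log dim`.** [cite: NielsenChuang2010, Theorem 11.8 (2) p.513] -/
theorem vonNeumannEntropy_le_log_card {n : Type*} [Fintype n] [DecidableEq n] {ρ : Matrix n n ℂ}
    (hρ : ρ.PosSemidef) (htr : ρ.trace = 1) : vonNeumannEntropy ρ ≤ Real.log (Fintype.card n) := by
  haveI : Nonempty n := by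
    by_contra h
    rw [not_nonempty_iff] at h
    have : ρ.trace = 0 := by simp [Matrix.trace]
    rw [this] at htr
    exact zero_ne_one htr
  have h := Matrix.sum_negMulLog_add_mul_le_log_sum_exp (fun i => hρ.eigenvalues_nonneg i)
    (sum_eigenvalues_eq_one hρ.1 htr) (fun _ => (0 : ℝ))
  simp only [mul_zero, Finset.sum_const_zero, add_zero, Real.exp_zero, Finset.sum_const, Finset.card_univ,
    nsmul_eq_mul, mul_one] at h
  rwa [vonNeumannEntropy_eq hρ.1]

/-- The one-site Fock space is four-dimensional. [folklore] -/
private theorem card_fock_singleton (z : Site d) :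
    Fintype.card (Finset (Orb (PolySite ({z} : Finset (Site d))))) = 4 := by
  rw [Fintype.card_finset, Fintype.card_lex, Fintype.card_prod, Fintype.card_fin, Fintype.card_coe, lexSites,
    Finset.card_map, Finset.card_singleton]
  norm_num

/-- **Every increment is at most `log 4`**: `S_ρ(Ω_{≤x}) ≤ S_ρ(Ω_{<x}) + S_ρ({x})` (subadditivity for even
states) and a single site carries a four-dimensional Fock space. [cite: ArakiMoriya2003, Theorem 3.8 and §10]
[cite: NielsenChuang2010, Theorem 11.8 (2) p.513] -/
theorem entropyIncrement_le_log_four {Ω : Finset (Site d)} {x : Lex (Site d)} (hx : ofLex x ∈ Ω)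
    {ρ : FermionOp Ω} (hρ : ρ.PosSemidef) (htr : ρ.trace = 1) (hev : parityAut ρ = ρ) :
    entropyIncrement ρ x ≤ Real.log 4 := by
  have hI : sitesBelow Ω x ⊆ Ω := Finset.filter_subset _ _
  have hU : sitesBelowEq Ω x ⊆ Ω := Finset.filter_subset _ _
  have hJ : ({ofLex x} : Finset (Site d)) ⊆ Ω := Finset.singleton_subset_iff.2 hx
  have hdisj : Disjoint (Set.range (PolySite.incl hI)) (Set.range (PolySite.incl hJ)) := by
    rw [Set.disjoint_iff]
    rintro y ⟨hyI, hyJ⟩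
    simp only [range_incl, Set.mem_setOf_eq, mem_sitesBelow, Finset.mem_singleton] at hyI hyJ
    have hlt := hyI.2
    rw [hyJ, toLex_ofLex] at hlt
    exact lt_irrefl _ hlt
  have hUr : Set.range (PolySite.incl hU) = Set.range (PolySite.incl hI) ∪ Set.range (PolySite.incl hJ) := by
    ext y
    simp only [range_incl, Set.mem_setOf_eq, Set.mem_union, mem_sitesBelow, mem_sitesBelowEq,
      Finset.mem_singleton]
    constructor
    · rintro ⟨hyΩ, hle⟩
      rcases hle.lt_or_eq with hlt | heq
      · exact Or.inl ⟨hyΩ, hlt⟩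
      · exact Or.inr (by rw [← heq, ofLex_toLex])
    · rintro (⟨hyΩ, hlt⟩ | hy)
      · exact ⟨hyΩ, hlt.le⟩
      · rw [hy, toLex_ofLex]
        exact ⟨hx, le_rfl⟩
  have key := fermion_subadditivity (PolySite.incl hI) (PolySite.incl hJ) (PolySite.incl hU) hdisj hUr hρ htr hev
  have h4 : vonNeumannEntropy (fermionPartialTrace (PolySite.incl hJ) ρ) ≤ Real.log 4 := by
    have h := vonNeumannEntropy_le_log_card (posSemidef_fermionPartialTrace (PolySite.incl hJ) hρ)
      (by rw [trace_fermionPartialTrace, htr])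
    rwa [card_fock_singleton, Nat.cast_ofNat] at h
  rw [entropyIncrement, regionEntropy_of_subset ρ hU, regionEntropy_of_subset ρ hI]
  linarith

/-! ### §4. The Markov (window) bound on the entropy -/

/-- **The Markov / window bound on the entropy of an even lattice-fermion state.** Let `ρ ∈ 𝔄_Ω` be an
even density matrix, `Λ` a window with lexicographically largest site `a`, and `V` a finite set of
translations with `Λ + v ⊆ Ω` for `v ∈ V`, such that the window entropies do not depend on the translate:
`S_ρ(Λ + v) = c_Λ` and `S_ρ((Λ∖a) + v) = c_B` (`v ∈ V`). Then
`S(ρ) ≤ |V|·(c_Λ − c_B) + (|Ω| − |V|)·log 4` — chain rule + SSA at the `|V|` corner sites, `log 4` at the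
others. For a translation-invariant torus state pulled back to `Ω = [0,L)^d` this is
`S(ρ_L) ≤ L^d · S(a | Λ∖a) + O(L^{d-1})`, the entropy half of the Markov-entropy-decomposition bound on the
pressure. [cite: PoulinHastings2011, eqs. (3)–(6)] [cite: ArakiMoriya2003, Theorem 3.8 and §10] -/
theorem vonNeumannEntropy_le_of_window_entropies {Ω Λ : Finset (Site d)} {a : Site d} (ha : a ∈ Λ)
    (hmax : ∀ y ∈ Λ, toLex y ≤ toLex a) (V : Finset (Site d)) (hV : ∀ v ∈ V, shiftSet v Λ ⊆ Ω)
    {ρ : FermionOp Ω} (hρ : ρ.PosSemidef) (htr : ρ.trace = 1) (hev : parityAut ρ = ρ) {cΛ cB : ℝ}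
    (hcΛ : ∀ v ∈ V, regionEntropy ρ (shiftSet v Λ) = cΛ)
    (hcB : ∀ v ∈ V, regionEntropy ρ (shiftSet v (Λ.erase a)) = cB) :
    vonNeumannEntropy ρ ≤ V.card * (cΛ - cB) + (Ω.card - V.card) * Real.log 4 := by
  classical
  rw [← sum_entropyIncrement hρ.1 htr]
  set C : Finset (Lex (Site d)) := V.image fun v => toLex (a + v) with hC
  have hCsub : C ⊆ lexSites Ω := by
    intro x hx
    obtain ⟨v, hv, rfl⟩ := Finset.mem_image.1 hx
    rw [mem_lexSites, ofLex_toLex]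
    exact hV v hv (PolySite.add_mem_shiftSet v ha)
  have hCcard : C.card = V.card :=
    Finset.card_image_of_injective _ fun v w h => add_left_cancel (toLex_inj.1 h)
  have h1 : ∑ x ∈ C, entropyIncrement ρ x ≤ C.card • (cΛ - cB) := by
    refine Finset.sum_le_card_nsmul _ _ _ fun x hx => ?_
    obtain ⟨v, hv, rfl⟩ := Finset.mem_image.1 hx
    have h := entropyIncrement_corner_le ha hmax (hV v hv) hρ htr hev
    rwa [hcΛ v hv, hcB v hv] at h
  have h2 : ∑ x ∈ lexSites Ω \ C, entropyIncrement ρ x ≤ (lexSites Ω \ C).card • Real.log 4 := by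
    refine Finset.sum_le_card_nsmul _ _ _ fun x hx => ?_
    have hx' : ofLex x ∈ Ω := mem_lexSites.1 (Finset.mem_sdiff.1 hx).1
    exact entropyIncrement_le_log_four hx' hρ htr hev
  have hcard : ((lexSites Ω \ C).card : ℝ) = Ω.card - V.card := by
    rw [Finset.card_sdiff_of_subset hCsub, Nat.cast_sub (Finset.card_le_card hCsub), hCcard, lexSites,
      Finset.card_map]
  rw [← Finset.sum_sdiff hCsub]
  rw [nsmul_eq_mul, hCcard] at h1
  rw [nsmul_eq_mul, hcard] at h2
  linarith

end Literature.MathematicalPhysics.QuantumLattice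

end
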